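import Mathlib

/-!
# Quartic discriminants, Vandermonde signs and Frobenius fixed points (algebra for Stage D1)

Helper file for item stmt-Langlands-13760 (`ResidualAutomorphyEven`, route `PicardMuOrdinary`): the
field-theoretic algebra behind "the cycle type of Frobenius on the four roots is read off from
`f mod 𝔭`" (Dedekind; Stickelberger's parity theorem for the discriminant):

* `discr_map_of_injective` — Mathlib's `Polynomial.discr` commutes with injective ring maps of
  domains (through `resultant_deriv` and `resultant_map_map`);
* `discr_splitQuartic` — for `f = c ∏_{i<4} (X - yᵢ)` over a field:
  `discr f = c⁶ (∏_{i<j} (yⱼ - yᵢ))²` (from `resultant_deriv`, `resultant_eq_prod_eval`);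
* `prodPairs_comp_perm` — `∏_{i<j} (y_{σ j} - y_{σ i}) = sign σ · ∏_{i<j} (yⱼ - yᵢ)`
  (Vandermonde determinant, `Matrix.det_permute`);
* `FiniteField.mem_range_iff_pow_card_eq` — for a homomorphism `ι : k → k'` of finite fields with
  `#k = q`: `x ∈ range ι ↔ x ^ q = x`.

Pure Mathlib algebra; no number theory, no named facts.
-/

set_option linter.dupNamespace false -- project-wide option (lakefile weak.linter.dupNamespace); `Summit.Langlands.Langlands` is the mandated namespace

noncomputable section

namespace Summit.Langlands.Langlands.Theorems.ResidualAutomorphyEven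

open Polynomial Equiv Finset Matrix

/-! ### `discr` and injective ring maps -/

/-- **`discr` commutes with injective ring homomorphisms** (between domains): through
`resultant_deriv` (`Res(f, f') = ± lc(f) · discr f`) and `resultant_map_map`. -/
theorem discr_map_of_injective {R S : Type*} [CommRing R] [IsDomain R] [CommRing S] [IsDomain S]
    (φ : R →+* S) (hφ : Function.Injective φ) (f : R[X]) (hf : 0 < f.degree) :
    (f.map φ).discr = φ f.discr := by
  have hdeg : (f.map φ).natDegree = f.natDegree := natDegree_map_eq_of_injective hφ f
  have hf' : 0 < (f.map φ).degree := by rwa [degree_map_eq_of_injective hφ]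
  have h1 := resultant_deriv hf'
  have h2 := congrArg φ (resultant_deriv hf)
  rw [← resultant_map_map, ← derivative_map, map_mul, map_mul, map_pow, map_neg, map_one, ← hdeg,
    ← leadingCoeff_map_of_injective hφ, h1] at h2
  have hlc : (f.map φ).leadingCoeff ≠ 0 := by
    rw [Ne, leadingCoeff_eq_zero]; rintro h0; rw [h0] at hf'; simp at hf'
  have hs : ((-1 : S) ^ ((f.map φ).natDegree * ((f.map φ).natDegree - 1) / 2)) ≠ 0 :=
    pow_ne_zero _ (neg_ne_zero.mpr one_ne_zero)
  exact mul_left_cancel₀ (mul_ne_zero hs hlc) h2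

/-! ### The discriminant of a split quartic -/

section Quartic

variable {F : Type*} [Field F]

/-- The monic split quartic `∏_{i<4} (X - yᵢ)`, written out. -/
def prodFour (y : Fin 4 → F) : F[X] := (X - C (y 0)) * (X - C (y 1)) * (X - C (y 2)) * (X - C (y 3))

/-- The split quartic `c ∏_{i<4} (X - yᵢ)`. -/
def splitQuartic (c : F) (y : Fin 4 → F) : F[X] := C c * prodFour y

/-- `∏ (X - yᵢ)` is monic. -/
theorem monic_prodFour (y : Fin 4 → F) : (prodFour y).Monic :=
  (((monic_X_sub_C _).mul (monic_X_sub_C _)).mul (monic_X_sub_C _)).mul (monic_X_sub_C _)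

/-- `∏ (X - yᵢ)` as a multiset product over the values `yᵢ`. -/
theorem prodFour_eq_multiset_prod (y : Fin 4 → F) :
    prodFour y = (((univ : Finset (Fin 4)).val.map y).map fun a => X - C a).prod := by
  rw [Multiset.map_map, ← Finset.prod_eq_multiset_prod, Fin.prod_univ_four, prodFour]
  rfl

/-- The roots of `∏ (X - yᵢ)` are the `yᵢ`. -/
theorem roots_prodFour (y : Fin 4 → F) : (prodFour y).roots = (univ : Finset (Fin 4)).val.map y := by
  rw [prodFour_eq_multiset_prod, roots_multiset_prod_X_sub_C]

/-- `∏_{i<4} (X - yᵢ)` has degree `4`. -/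
theorem natDegree_prodFour (y : Fin 4 → F) : (prodFour y).natDegree = 4 := by
  rw [prodFour_eq_multiset_prod, natDegree_multiset_prod_X_sub_C_eq_card]
  simp

/-- `∏_{i<j} (yⱼ - yᵢ)` for `Fin 4`, written out. -/
theorem prod_Ioi_four {R : Type*} [CommMonoid R] (g : Fin 4 → Fin 4 → R) :
    (∏ i : Fin 4, ∏ j ∈ Ioi i, g i j) = g 0 1 * (g 0 2 * g 0 3) * (g 1 2 * g 1 3) * g 2 3 := by
  have h0 : Ioi (0 : Fin 4) = {1, 2, 3} := by decide
  have h1 : Ioi (1 : Fin 4) = {2, 3} := by decide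
  have h2 : Ioi (2 : Fin 4) = {3} := by decide
  have h3 : Ioi (3 : Fin 4) = ∅ := by decide
  rw [Fin.prod_univ_four, h0, h1, h2, h3, prod_insert (by decide), prod_insert (by decide),
    prod_singleton, prod_insert (by decide), prod_singleton, prod_singleton, prod_empty, mul_one]

variable {c : F} (y : Fin 4 → F)

/-- The leading coefficient of `c ∏ (X - yᵢ)` is `c`. -/
theorem leadingCoeff_splitQuartic : (splitQuartic c y).leadingCoeff = c := by
  rw [splitQuartic, leadingCoeff_mul, leadingCoeff_C, (monic_prodFour y).leadingCoeff, mul_one]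

/-- The derivative of the split quartic at the four roots: `c ∏_{j ≠ i} (yᵢ - yⱼ)`. -/
theorem eval_derivative_splitQuartic :
    ((splitQuartic c y).derivative).eval (y 0) = c * ((y 0 - y 1) * (y 0 - y 2) * (y 0 - y 3)) ∧
    ((splitQuartic c y).derivative).eval (y 1) = c * ((y 1 - y 0) * (y 1 - y 2) * (y 1 - y 3)) ∧
    ((splitQuartic c y).derivative).eval (y 2) = c * ((y 2 - y 0) * (y 2 - y 1) * (y 2 - y 3)) ∧
    ((splitQuartic c y).derivative).eval (y 3) = c * ((y 3 - y 0) * (y 3 - y 1) * (y 3 - y 2)) := by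
  simp only [splitQuartic, prodFour, derivative_mul, derivative_C, derivative_sub, derivative_X,
    zero_mul, zero_add, sub_zero, mul_one, eval_add, eval_mul, eval_sub, eval_X, eval_C, eval_one]
  refine ⟨?_, ?_, ?_, ?_⟩ <;> ring

variable (hc : c ≠ 0)
include hc

/-- `c ∏_{i<4} (X - yᵢ)` has degree `4` for `c ≠ 0`. -/
theorem natDegree_splitQuartic : (splitQuartic c y).natDegree = 4 := by
  rw [splitQuartic, natDegree_C_mul hc, natDegree_prodFour]

/-- `c ∏_{i<4} (X - yᵢ)` has positive degree for `c ≠ 0`. -/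
theorem degree_splitQuartic_pos : 0 < (splitQuartic c y).degree := by
  rw [← natDegree_pos_iff_degree_pos, natDegree_splitQuartic y hc]; norm_num

/-- The roots of `c ∏ (X - yᵢ)` are the `yᵢ` (`c ≠ 0`). -/
theorem roots_splitQuartic : (splitQuartic c y).roots = (univ : Finset (Fin 4)).val.map y := by
  rw [splitQuartic, roots_C_mul _ hc, roots_prodFour]

/-- `c ∏ (X - yᵢ)` splits. -/
theorem splits_splitQuartic : (splitQuartic c y).Splits := by
  rw [splits_iff_card_roots, roots_splitQuartic y hc, natDegree_splitQuartic y hc]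
  simp

/-- **Discriminant of a split quartic**: `discr (c ∏ (X - yᵢ)) = c⁶ (∏_{i<j} (yⱼ - yᵢ))²`. -/
theorem discr_splitQuartic :
    (splitQuartic c y).discr = c ^ 6 * (∏ i : Fin 4, ∏ j ∈ Ioi i, (y j - y i)) ^ 2 := by
  have hd := natDegree_splitQuartic y hc
  have h1 := resultant_deriv (degree_splitQuartic_pos y hc)
  have h2 := resultant_eq_prod_eval (splitQuartic c y) (splitQuartic c y).derivative 3
    (by have := natDegree_derivative_le (splitQuartic c y); omega) (splits_splitQuartic y hc)
  rw [hd, leadingCoeff_splitQuartic] at h1 h2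
  norm_num at h1
  obtain ⟨e0, e1, e2, e3⟩ := eval_derivative_splitQuartic (c := c) y
  rw [h1, roots_splitQuartic y hc] at h2
  simp only [Fin.univ_val_map, List.ofFn_succ, Fin.succ_zero_eq_one, Fin.succ_one_eq_two,
    List.ofFn_zero, Multiset.map_coe, List.map_cons, List.map_nil, Multiset.prod_coe, List.prod_cons,
    List.prod_nil, mul_one] at h2
  rw [e0, e1, e2] at h2
  have e3' : eval (y (Fin.succ 2)) (derivative (splitQuartic c y)) =
      c * ((y 3 - y 0) * (y 3 - y 1) * (y 3 - y 2)) := e3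
  rw [e3'] at h2
  have key : c * (splitQuartic c y).discr =
      c * (c ^ 6 * (∏ i : Fin 4, ∏ j ∈ Ioi i, (y j - y i)) ^ 2) := by
    rw [h2, prod_Ioi_four]
    ring
  exact mul_left_cancel₀ hc key

end Quartic

/-! ### Permuting the roots multiplies `∏_{i<j} (yⱼ - yᵢ)` by the sign -/

/-- `∏_{i<j} (yⱼ - yᵢ)`, the Vandermonde determinant of `y`. -/
def prodPairs {R : Type*} [CommRing R] {n : ℕ} (y : Fin n → R) : R := ∏ i : Fin n, ∏ j ∈ Ioi i, (y j - y i)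

/-- `prodPairs y` is the Vandermonde determinant (`Matrix.det_vandermonde`). -/
theorem prodPairs_eq_det {R : Type*} [CommRing R] {n : ℕ} (y : Fin n → R) :
    prodPairs y = (vandermonde y).det := (det_vandermonde y).symm

/-- **`∏_{i<j} (y_{σ j} - y_{σ i}) = sign σ · ∏_{i<j} (yⱼ - yᵢ)`** (permute the rows of the
Vandermonde matrix, `Matrix.det_permute`). -/
theorem prodPairs_comp_perm {R : Type*} [CommRing R] {n : ℕ} (y : Fin n → R) (σ : Perm (Fin n)) :
    prodPairs (y ∘ σ) = (Perm.sign σ : ℤ) * prodPairs y := by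
  rw [prodPairs_eq_det, prodPairs_eq_det, ← det_permute]
  congr 1

/-- A ring homomorphism maps `prodPairs`. -/
theorem map_prodPairs {R S : Type*} [CommRing R] [CommRing S] (φ : R →+* S) {n : ℕ} (y : Fin n → R) :
    φ (prodPairs y) = prodPairs (φ ∘ y) := by
  simp [prodPairs, map_prod]

/-- `prodPairs y ≠ 0` for injective `y` over a domain. -/
theorem prodPairs_ne_zero {R : Type*} [CommRing R] [IsDomain R] {n : ℕ} {y : Fin n → R}
    (hy : Function.Injective y) : prodPairs y ≠ 0 := by
  rw [prodPairs_eq_det, Ne, det_vandermonde_eq_zero_iff]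
  rintro ⟨i, j, hij, hne⟩
  exact hne (hy hij)

/-! ### Finite fields: the image of the small field is the set of `q`-th-power-fixed elements -/

/-- **For finite fields `ι : k ↪ k'` with `#k = q`: `x ∈ range ι ↔ x ^ q = x`** (`→`:
`a ^ q = a` in `k`; `←`: `X ^ q - X` has at most `q` roots in `k'`, and `ι(k)` already supplies `q`
of them). -/
theorem FiniteField.mem_range_iff_pow_card_eq {k k' : Type*} [Field k] [Finite k] [Field k']
    [Finite k'] (ι : k →+* k') (x : k') :
    x ∈ Set.range ι ↔ x ^ Nat.card k = x := by
  classical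
  haveI := Fintype.ofFinite k
  haveI := Fintype.ofFinite k'
  rw [Nat.card_eq_fintype_card]
  constructor
  · rintro ⟨a, rfl⟩
    rw [← map_pow, FiniteField.pow_card]
  · intro hx
    have hq1 : 1 < Fintype.card k := Fintype.one_lt_card
    -- the fixed elements form a finset `S` of card `≤ q` containing the image `T`, of card `q`
    let S : Finset k' := univ.filter fun z => z ^ Fintype.card k = z
    let T : Finset k' := univ.image ι
    have hTS : T ⊆ S := by
      intro z hz
      obtain ⟨a, -, rfl⟩ := Finset.mem_image.mp hz
      exact Finset.mem_filter.mpr ⟨mem_univ _, by rw [← map_pow, FiniteField.pow_card]⟩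
    have hTcard : T.card = Fintype.card k := by
      rw [Finset.card_image_of_injective _ ι.injective, Finset.card_univ]
    have hScard : S.card ≤ Fintype.card k := by
      have hne : (X ^ Fintype.card k - X : k'[X]) ≠ 0 := FiniteField.X_pow_card_sub_X_ne_zero k' hq1
      have hsub : S.val ⊆ (X ^ Fintype.card k - X : k'[X]).roots := by
        intro z hz
        rw [Finset.mem_val, Finset.mem_filter] at hz
        rw [mem_roots hne, IsRoot, eval_sub, eval_pow, eval_X, hz.2, sub_self]
      calc S.card = Multiset.card S.val := rfl
        _ ≤ Multiset.card (X ^ Fintype.card k - X : k'[X]).roots :=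
            Multiset.card_le_card ((Multiset.le_iff_subset S.nodup).mpr hsub)
        _ ≤ (X ^ Fintype.card k - X : k'[X]).natDegree := card_roots' _
        _ = Fintype.card k := FiniteField.X_pow_card_sub_X_natDegree_eq k' hq1
    have hST : S = T := (Finset.eq_of_subset_of_card_le hTS (hTcard ▸ hScard)).symm
    have hxS : x ∈ S := Finset.mem_filter.mpr ⟨mem_univ _, hx⟩
    rw [hST, Finset.mem_image] at hxS
    obtain ⟨a, -, ha⟩ := hxS
    exact ⟨a, ha⟩

end Summit.Langlands.Langlands.Theorems.ResidualAutomorphyEven
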